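import Summits.QuantumAdvantage.QuantumAdvantage.Theorems.CharDialSegmentMovesA
import Summits.QuantumAdvantage.AdviceFreeQNC0.WalkHardFJuntaCuts
import HarnessLib

/-!
# Segment moves, part B: form increments and the swap-influence (variation) quantities (decomp-qadv lens-6 g17, tree part 30B)

How a junta ⊕ `𝔽_p`-form cut reacts to a segment move: the form moves by `Σ_{t ∈ [i,j)} ±a_t` (`SegMove.form_segCompl`); a swap of two
different bits at a position where the coefficient vector does not jump, read by a cut whose junta avoids the two positions, is invisible
(`SegMove.cut_swap_insensitive`).  The VARIATION quantities of a strategy: `swapInf y g i` (inputs with `u_i ≠ u_{i+1}` on which cut `g`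
changes its output under the swap), `swapMass y i = Σ_g swapInf y g i`, `lowPositions n y B = {i < n : swapMass y i ≤ B·2ⁿ}`; and the
LOW-SIDE CERTIFICATES: structurally few sensitive cuts at half the positions ⇒ half the positions are low (`SegMove.low_of_few_sensitive`),
in particular every strategy whose cuts are `log₂ n`-juntas ⊕ forms jumping only at the cut (prefix / suffix / global / two-sided counters)
has at least `n/2` positions of swap mass `≤ 4(log₂ n + 1)·2ⁿ` (`SegMove.low_of_oneJump_junta`, every `n`; Markov on reader incidences via
`Junta.sum_card_readers_eq`).  Supports item stmt-QuantumAdvantage-32604; source: pub annex g17/OrbitDial37.lean §37d–§37e (sha256 9083c6e4…).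
-/

set_option autoImplicit false

namespace Summit.QuantumAdvantage.AdviceFreeQNC0.JLinPeel.SegMove

open Finset
open Summit.QuantumAdvantage.AdviceFreeQNC0

variable {n : ℕ}

/-! ### form increments: which cuts a move can touch -/

section Forms

variable {p : ℕ}

/-- the `𝔽_p`-form of a cut, as in the CharDial hypothesis. -/
def form (a : Fin n → ZMod p) (u : Fin n → Bool) : ZMod p := ∑ i, if u i then a i else 0

/-- **form increment.** complementing `[i, j)` adds `Σ_{t ∈ [i,j)} (±a_t)` (`+` where `u_t = 0`, `−` where `u_t = 1`). -/
theorem form_segCompl (a : Fin n → ZMod p) (u : Fin n → Bool) (i j : ℕ) :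
    form a (segCompl u i j) = form a u + ∑ t, if i ≤ t.val ∧ t.val < j then (if u t then -a t else a t) else 0 := by
  unfold form
  rw [← sum_add_distrib]
  refine sum_congr rfl fun t _ => ?_
  simp only [segCompl_apply]
  rcases Bool.eq_false_or_eq_true (u t) with hut | hut <;> by_cases hw : i ≤ t.val ∧ t.val < j <;> simp [hw, hut]

/-- the swap case: at a window `[i, i+2)` carrying two DIFFERENT bits the form moves by `±(a_i − a_{i+1})`;
in particular a cut with `a_i = a_{i+1}` does not feel the swap through its form. -/
theorem form_swap_of_eq (a : Fin n → ZMod p) (u : Fin n → Bool) (s t : Fin n) (hs : t.val = s.val + 1)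
    (hne : u s ≠ u t) (ha : a s = a t) : form a (segCompl u s.val (s.val + 2)) = form a u := by
  rw [form_segCompl]
  suffices (∑ x : Fin n, if s.val ≤ x.val ∧ x.val < s.val + 2 then (if u x = true then -a x else a x) else 0) = 0 by
    rw [this, add_zero]
  have hwin : ∀ x : Fin n, (s.val ≤ x.val ∧ x.val < s.val + 2) ↔ (x = s ∨ x = t) := by
    intro x
    constructor
    · intro h
      rcases Nat.lt_or_ge x.val (s.val + 1) with h1 | h1
      · left; exact Fin.ext (by omega)
      · right; exact Fin.ext (by omega)
    · rintro (rfl | rfl) <;> omega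
  have hst : s ≠ t := fun h => by rw [h] at hs; omega
  rw [show (∑ x : Fin n, if s.val ≤ x.val ∧ x.val < s.val + 2 then (if u x = true then -a x else a x) else 0)
      = ∑ x ∈ ({s, t} : Finset (Fin n)), (if u x = true then -a x else a x) by
    rw [← sum_filter]
    congr 1
    ext x; simp only [mem_filter, mem_univ, true_and, mem_insert, mem_singleton, hwin]]
  rw [sum_pair hst, ha]
  revert hne
  rcases Bool.eq_false_or_eq_true (u s) with h1 | h1 <;>
    rcases Bool.eq_false_or_eq_true (u t) with h2 | h2 <;> simp [h1, h2]

/-- **structural insensitivity.** a junta ⊕ form cut whose junta avoids `{i, i+1}` and whose form has `a_i = a_{i+1}` gives the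
same output on `u` and on the swapped input. (This is why bounded-variation forms — prefix / suffix / global / two-sided
counters, all the PROVED faces — live on the LOW side of the dial: their cuts feel only the swaps at their own steps.) -/
theorem cut_swap_insensitive (J : Finset (Fin n)) (a : Fin n → ZMod p) (h : (Fin n → Bool) → ZMod p → Bool)
    (hJ : ∀ u v : Fin n → Bool, (∀ i ∈ J, u i = v i) → ∀ s, h u s = h v s)
    (u : Fin n → Bool) (s t : Fin n) (hs : t.val = s.val + 1) (hne : u s ≠ u t) (ha : a s = a t)
    (hsJ : s ∉ J) (htJ : t ∉ J) :
    h (segCompl u s.val (s.val + 2)) (form a (segCompl u s.val (s.val + 2))) = h u (form a u) := by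
  rw [form_swap_of_eq a u s t hs hne ha]
  refine hJ _ _ (fun x hx => segCompl_of_not_mem u x ?_) _
  rintro ⟨h1, h2⟩
  rcases Nat.lt_or_ge x.val (s.val + 1) with h3 | h3
  · exact hsJ (by rwa [show x = s from Fin.ext (by omega)] at hx)
  · exact htJ (by rwa [show x = t from Fin.ext (by omega)] at hx)

end Forms

/-! ### the swap-influence (variation) quantities -/

section Dial

/-- adjacent positions `i, i+1` of `u` carry different bits (Boolean test). -/
def neAdj (u : Fin n → Bool) (i : ℕ) : Bool := decide (∃ s t : Fin n, s.val = i ∧ t.val = i + 1 ∧ u s ≠ u t)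

/-- specification of `neAdj`. -/
theorem neAdj_iff (u : Fin n → Bool) (i : ℕ) : neAdj u i = true ↔ ∃ s t : Fin n, s.val = i ∧ t.val = i + 1 ∧ u s ≠ u t := by
  unfold neAdj; rw [decide_eq_true_iff]

/-- **swap influence** of cut `g` at position `i`: the number of inputs with `u_i ≠ u_{i+1}` on which swapping the two bits
(= `segCompl u i (i+2)`) changes the output of cut `g`. -/
def swapInf (y : Fin (n + 1) → (Fin n → Bool) → Bool) (g : Fin (n + 1)) (i : ℕ) : ℕ :=
  (univ.filter fun u : Fin n → Bool => neAdj u i = true ∧ y g (segCompl u i (i + 2)) ≠ y g u).card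

/-- **swap-influence mass** of position `i`: total swap influence over all cuts (a number in `[0, (n+1)·2ⁿ]`). -/
def swapMass (y : Fin (n + 1) → (Fin n → Bool) → Bool) (i : ℕ) : ℕ := ∑ g : Fin (n + 1), swapInf y g i

/-- positions of LOW variation: swap-influence mass at most `B·2ⁿ` (i.e. at most `B` cuts' worth of full influence). -/
def lowPositions (n : ℕ) (y : Fin (n + 1) → (Fin n → Bool) → Bool) (B : ℕ) : Finset ℕ :=
  (range n).filter fun i => swapMass y i ≤ B * 2 ^ n

/-- **why the LOW side is the structured side (structural half of the private-token mechanism).** a junta ⊕ form cut whose junta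
avoids `{i, i+1}` and whose form does not jump at `i` has swap influence ZERO at `i`. -/
theorem swapInf_eq_zero (y : Fin (n + 1) → (Fin n → Bool) → Bool) (g : Fin (n + 1)) {p : ℕ}
    (J : Finset (Fin n)) (a : Fin n → ZMod p) (h : (Fin n → Bool) → ZMod p → Bool)
    (hJ : ∀ u v : Fin n → Bool, (∀ i ∈ J, u i = v i) → ∀ s, h u s = h v s)
    (hy : ∀ u, y g u = h u (∑ i, if u i then a i else 0))
    (s t : Fin n) (hs : t.val = s.val + 1) (ha : a s = a t) (hsJ : s ∉ J) (htJ : t ∉ J) :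
    swapInf y g s.val = 0 := by
  unfold swapInf
  rw [card_eq_zero, filter_eq_empty_iff]
  rintro u - ⟨hne', hch⟩
  obtain ⟨s', t', hs', ht', hne⟩ := (neAdj_iff u _).1 hne'
  have hss : s' = s := Fin.ext (by omega)
  have htt : t' = t := Fin.ext (by omega)
  subst hss; subst htt
  apply hch
  rw [hy, hy]
  exact cut_swap_insensitive J a h hJ u s' t' (by omega) hne ha hsJ htJ


/-- swap influence never exceeds `2ⁿ`. -/
theorem swapInf_le (y : Fin (n + 1) → (Fin n → Bool) → Bool) (g : Fin (n + 1)) (i : ℕ) : swapInf y g i ≤ 2 ^ n := by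
  unfold swapInf
  calc _ ≤ (univ : Finset (Fin n → Bool)).card := card_le_univ _
    _ = 2 ^ n := by rw [card_univ, Fintype.card_fun, Fintype.card_bool, Fintype.card_fin]

/-- at the last position (or beyond) nothing can be swapped: influence `0`. -/
theorem swapInf_eq_zero_of_le (y : Fin (n + 1) → (Fin n → Bool) → Bool) (g : Fin (n + 1)) {i : ℕ} (hi : n ≤ i + 1) :
    swapInf y g i = 0 := by
  unfold swapInf
  rw [card_eq_zero, filter_eq_empty_iff]
  rintro u - ⟨hne, -⟩
  obtain ⟨s, t, hs, ht, -⟩ := (neAdj_iff u _).1 hne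
  have := t.isLt
  omega

/-- **LOW-SIDE CERTIFICATE.** explicit junta ⊕ form data in which, at each of at least `n/2` positions `i`, at most `B n` cuts are
STRUCTURALLY sensitive (junta meets `{i, i+1}` or the form jumps, `a_i ≠ a_{i+1}`) has at least `n/2` positions of swap mass `≤ B n · 2ⁿ`. -/
theorem low_of_few_sensitive {p : ℕ} (B : ℕ → ℕ) (y : Fin (n + 1) → (Fin n → Bool) → Bool)
    (J : Fin (n + 1) → Finset (Fin n)) (a : Fin (n + 1) → Fin n → ZMod p)
    (h : Fin (n + 1) → (Fin n → Bool) → ZMod p → Bool)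
    (hJ : ∀ g, ∀ u v : Fin n → Bool, (∀ i ∈ J g, u i = v i) → ∀ s, h g u s = h g v s)
    (hy : ∀ g u, y g u = h g u (∑ i, if u i then a g i else 0))
    (P : Finset (Fin n)) (hP : n ≤ 2 * P.card)
    (hfew : ∀ s ∈ P, ∀ t : Fin n, t.val = s.val + 1 →
      (univ.filter fun g : Fin (n + 1) => s ∈ J g ∨ t ∈ J g ∨ a g s ≠ a g t).card ≤ B n) :
    n ≤ 2 * (lowPositions n y (B n)).card := by
  classical
  -- every position in `P` is a low position
  have hsub : P.image (fun s : Fin n => s.val) ⊆ lowPositions n y (B n) := by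
    intro i hi
    rw [mem_image] at hi
    obtain ⟨s, hsP, rfl⟩ := hi
    unfold lowPositions
    rw [mem_filter, mem_range]
    refine ⟨s.isLt, ?_⟩
    unfold swapMass
    by_cases hlast : n ≤ s.val + 1
    · rw [sum_eq_zero fun g _ => swapInf_eq_zero_of_le y g hlast]; exact Nat.zero_le _
    · push Not at hlast
      set t : Fin n := ⟨s.val + 1, hlast⟩ with ht
      set S := univ.filter fun g : Fin (n + 1) => s ∈ J g ∨ t ∈ J g ∨ a g s ≠ a g t with hS
      have hsplit : ∑ g : Fin (n + 1), swapInf y g s.val = ∑ g ∈ S, swapInf y g s.val := by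
        rw [hS, sum_filter]
        refine sum_congr rfl fun g _ => ?_
        split_ifs with hsens
        · rfl
        · push Not at hsens
          exact swapInf_eq_zero y g (J g) (a g) (h g) (hJ g) (hy g) s t rfl hsens.2.2 hsens.1 hsens.2.1
      rw [hsplit]
      calc ∑ g ∈ S, swapInf y g s.val ≤ ∑ g ∈ S, 2 ^ n := sum_le_sum fun g _ => swapInf_le y g _
        _ = S.card * 2 ^ n := by rw [sum_const, smul_eq_mul]
        _ ≤ B n * 2 ^ n := Nat.mul_le_mul_right _ (hfew s hsP t rfl)
  have hcard : P.card ≤ (lowPositions n y (B n)).card := by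
    calc P.card = (P.image fun s : Fin n => s.val).card := (card_image_of_injective _ Fin.val_injective).symm
      _ ≤ _ := card_le_card hsub
  omega


/-- readers of position `a`. -/
def readers (J : Fin (n + 1) → Finset (Fin n)) (a : ℕ) : ℕ :=
  (univ.filter fun g : Fin (n + 1) => ∃ j ∈ J g, j.val = a).card

/-- membership form of `readers`. -/
theorem readers_eq (J : Fin (n + 1) → Finset (Fin n)) (s : Fin n) :
    (univ.filter fun g : Fin (n + 1) => s ∈ J g).card = readers J s.val := by
  unfold readers
  congr 1; ext g; simp only [mem_filter, mem_univ, true_and]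
  constructor
  · intro h; exact ⟨s, h, rfl⟩
  · rintro ⟨j, hj, hjs⟩; rwa [show s = j from Fin.ext hjs.symm]

/-- no readers beyond the last position. -/
theorem readers_out (J : Fin (n + 1) → Finset (Fin n)) {a : ℕ} (ha : n ≤ a) : readers J a = 0 := by
  unfold readers
  rw [card_eq_zero, filter_eq_empty_iff]
  rintro g - ⟨j, -, hj⟩
  have := j.isLt; omega

/-- total reader incidences `≤ (n+1)·Λ`. -/
theorem sum_readers_le (J : Fin (n + 1) → Finset (Fin n)) {Λ : ℕ} (hJ : ∀ g, (J g).card ≤ Λ) :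
    ∑ a ∈ range n, readers J a ≤ (n + 1) * Λ := by
  unfold readers
  rw [Junta.sum_card_readers_eq J]
  calc (∑ g : Fin (n + 1), (J g).card) ≤ ∑ _g : Fin (n + 1), Λ := sum_le_sum fun g _ => hJ g
    _ = (n + 1) * Λ := by simp

/-- shifted total reader incidences `≤ (n+1)·Λ`. -/
theorem sum_readers_succ_le (J : Fin (n + 1) → Finset (Fin n)) {Λ : ℕ} (hJ : ∀ g, (J g).card ≤ Λ) :
    ∑ a ∈ range n, readers J (a + 1) ≤ (n + 1) * Λ := by
  have h := sum_readers_le J hJ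
  have hshift : ∑ a ∈ range n, readers J (a + 1) ≤ ∑ a ∈ range n, readers J a := by
    cases n with
    | zero => simp
    | succ m =>
      rw [Finset.sum_range_succ' (fun a => readers J a), Finset.sum_range_succ (fun a => readers J (a + 1)),
        readers_out J (le_refl _)]
      omega
  exact hshift.trans h

/-- **the ONE-JUMP ⊕ JUNTA family is LOW.** if every cut is a `log₂ n`-junta ⊕ a form whose coefficient vector jumps only at the cut itself
(`a_{g,s} ≠ a_{g,s+1} ⇒ g = s+1`: prefix / suffix / global / two-sided counters with arbitrary multipliers), then at least `n/2` positions
have swap mass `≤ 4(log₂ n + 1)·2ⁿ` — for EVERY `n`. -/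
theorem low_of_oneJump_junta {p : ℕ} (y : Fin (n + 1) → (Fin n → Bool) → Bool)
    (J : Fin (n + 1) → Finset (Fin n)) (a : Fin (n + 1) → Fin n → ZMod p)
    (h : Fin (n + 1) → (Fin n → Bool) → ZMod p → Bool)
    (hJc : ∀ g, (J g).card ≤ Nat.log 2 n)
    (hJ : ∀ g, ∀ u v : Fin n → Bool, (∀ i ∈ J g, u i = v i) → ∀ s, h g u s = h g v s)
    (hy : ∀ g u, y g u = h g u (∑ i, if u i then a g i else 0))
    (hjump : ∀ g (s t : Fin n), t.val = s.val + 1 → a g s ≠ a g t → g.val = s.val + 1) :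
    n ≤ 2 * (lowPositions n y (4 * (Nat.log 2 n + 1))).card := by
  classical
  set L := Nat.log 2 n with hL
  set P : Finset (Fin n) := univ.filter fun s => readers J s.val + readers J (s.val + 1) + 1 ≤ 4 * (Nat.log 2 n + 1) with hP
  refine low_of_few_sensitive (fun m => 4 * (Nat.log 2 m + 1)) y J a h hJ hy P ?_ ?_
  · -- Markov: few bad positions
    set Bad : Finset (Fin n) := univ.filter fun s => ¬ (readers J s.val + readers J (s.val + 1) + 1 ≤ 4 * (Nat.log 2 n + 1)) with hBad
    have hsplit : P.card + Bad.card = n := by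
      rw [hP, hBad, card_filter_add_card_filter_not, card_univ, Fintype.card_fin]
    have hmark : Bad.card * (4 * L + 4) ≤ 2 * ((n + 1) * L) := by
      have h1 : Bad.card * (4 * L + 4) ≤ ∑ s ∈ Bad, (readers J s.val + readers J (s.val + 1)) := by
        rw [← smul_eq_mul, ← sum_const]
        refine sum_le_sum fun s hs => ?_
        rw [hBad, mem_filter] at hs
        have := hs.2
        omega
      have h2 : ∑ s ∈ Bad, (readers J s.val + readers J (s.val + 1))
          ≤ ∑ s : Fin n, (readers J s.val + readers J (s.val + 1)) :=
        sum_le_sum_of_subset_of_nonneg (subset_univ _) fun _ _ _ => Nat.zero_le _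
      have h3 : ∑ s : Fin n, (readers J s.val + readers J (s.val + 1))
          = ∑ a ∈ range n, readers J a + ∑ a ∈ range n, readers J (a + 1) := by
        rw [sum_add_distrib, Fin.sum_univ_eq_sum_range (fun a => readers J a),
          Fin.sum_univ_eq_sum_range (fun a => readers J (a + 1))]
      have h4 := sum_readers_le J hJc
      have h5 := sum_readers_succ_le J hJc
      omega
    have hbad : 2 * Bad.card ≤ n := by
      by_contra hc
      push Not at hc
      -- Bad.card * (4L+4) ≥ ... contradiction
      have : (n + 1) * (4 * L + 4) ≤ 2 * Bad.card * (4 * L + 4) := Nat.mul_le_mul_right _ (by omega)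
      nlinarith
    omega
  · intro s hs t hst
    rw [hP, mem_filter] at hs
    have hsub : (univ.filter fun g : Fin (n + 1) => s ∈ J g ∨ t ∈ J g ∨ a g s ≠ a g t)
        ⊆ (univ.filter fun g : Fin (n + 1) => s ∈ J g) ∪ (univ.filter fun g : Fin (n + 1) => t ∈ J g)
          ∪ (univ.filter fun g : Fin (n + 1) => g.val = s.val + 1) := by
      intro g hg
      simp only [mem_filter, mem_univ, true_and, mem_union] at hg ⊢
      rcases hg with h1 | h1 | h1
      · exact Or.inl (Or.inl h1)
      · exact Or.inl (Or.inr h1)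
      · exact Or.inr (hjump g s t hst h1)
    have hone : (univ.filter fun g : Fin (n + 1) => g.val = s.val + 1).card ≤ 1 := by
      rw [card_le_one]
      intro x hx z hz
      simp only [mem_filter, mem_univ, true_and] at hx hz
      exact Fin.ext (by omega)
    calc _ ≤ ((univ.filter fun g : Fin (n + 1) => s ∈ J g) ∪ (univ.filter fun g : Fin (n + 1) => t ∈ J g)
          ∪ (univ.filter fun g : Fin (n + 1) => g.val = s.val + 1)).card := card_le_card hsub
      _ ≤ ((univ.filter fun g : Fin (n + 1) => s ∈ J g) ∪ (univ.filter fun g : Fin (n + 1) => t ∈ J g)).card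
          + (univ.filter fun g : Fin (n + 1) => g.val = s.val + 1).card := card_union_le _ _
      _ ≤ (univ.filter fun g : Fin (n + 1) => s ∈ J g).card + (univ.filter fun g : Fin (n + 1) => t ∈ J g).card
          + (univ.filter fun g : Fin (n + 1) => g.val = s.val + 1).card :=
            Nat.add_le_add_right (card_union_le _ _) _
      _ ≤ 4 * (Nat.log 2 n + 1) := by rw [readers_eq, readers_eq, hst]; omega


end Dial

end Summit.QuantumAdvantage.AdviceFreeQNC0.JLinPeel.SegMove
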